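import Summits.Schanuel.Schanuel.Theorems.RootDecomp1BDefectFloorChannelsBase

/-!
# RootDecomp1BDefectFloorChannels — part 2 of 3 (lens-4 g10 NODE «Channels» = ROUND 10 of route-Schanuel-RootDecomp1B, a THEOREM ROUND;
# § Gen 10 of HOME/decomp-schanuel-lens-4/g10/Channels.lean (c3aeda0d…), `--supports stmt-Schanuel-32406`)

The floor SRL(r′ ∣ u) is a THREE-CHANNEL statement: ONE of the coordinate u / modulus e^u / phase e^{iu} of the last coordinate is
transcendental over the polar field F(r′) (`sharpRelativeLindemannAt_of_coordinate` / `_modulus` / `_phase_channel`). New decided cells with a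
DARK coordinate channel: the LW phase family (β ∣ γ + qπ) ∀ m and modulus family (β ∣ γ + log α) ∀ m (`algebraicIndependent_exp_holds`), the
Nesterenko cells (π ∣ log Γ(1/4)) and (π ∣ arctan Γ(1/4)) (mod `nesterenko`); channel certificates; the census theorem «rounds ≤ 9 were
coordinate-only». Extracted mechanically (dependency closure over the landed DefectFloor files: 64 § Gen 10 declarations + 11 earlier ones never
landed — `relDeg`, `polarDeg_eq_init_add_relDeg`, `sharpRelativeLindemannAt_iff_relDeg`, `one_le_relDeg_of_transcendental`, `init_piGamma`, …);
all parts share the namespace `Summit.Schanuel.Schanuel.Theorems.RootDecomp1BDefectFloorChannels`; twins of landed declarations are `open`ed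
(FedFlagCore / TameFlagCore / DefectFloorDefs / Core / Cells) or private copies; sorry-free; standard axioms.
-/

open Complex IntermediateField
open Literature.NumberTheory.Transcendental (trdeg_adjoin_le_of_le isAlgebraic_adjoin_over_algebraAdjoin nesterenko algebraicIndependent_exp_holds transcendental_pi_holds)

namespace Summit.Schanuel.Schanuel.Theorems.RootDecomp1BDefectFloorChannels

set_option linter.dupNamespace false

open Summit.Schanuel.Schanuel.Theorems.RootDecomp1BFedFlagCore
open Summit.Schanuel.Schanuel.Theorems.RootDecomp1BTameFlagCore
open Summit.Schanuel.Schanuel.Theorems.RootDecomp1BDefectFloorDefs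
open Summit.Schanuel.Schanuel.Theorems.RootDecomp1BDefectFloorCore
open Summit.Schanuel.Schanuel.Theorems.RootDecomp1BDefectFloorCells

section

variable {m : ℕ}

set_option synthInstance.maxHeartbeats 200000 in
/-- Monotonicity of transcendence degree under inclusion of generators. [folklore] -/
private theorem trdeg_adjoin_mono {S T : Set ℂ} (h : S ⊆ T) :
    Algebra.trdeg ℚ ↥(IntermediateField.adjoin ℚ S) ≤ Algebra.trdeg ℚ ↥(IntermediateField.adjoin ℚ T) :=
  trdeg_le_of_injective (IntermediateField.inclusion (IntermediateField.adjoin.mono ℚ S T h))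
    (IntermediateField.inclusion_injective _)

/-- `T` algebraic over `K` ⟹ `trdeg_ℚ ℚ(T) ≤ trdeg_ℚ K`. [folklore; lens-2 `DefectLattice.trdeg_adjoin_le_of_isAlgebraic`] -/
private theorem trdeg_adjoin_le_of_isAlgebraic (K : IntermediateField ℚ ℂ) {T : Set ℂ}
    (hT : ∀ x ∈ T, IsAlgebraic K x) :
    Algebra.trdeg ℚ ↥(adjoin ℚ T) ≤ Algebra.trdeg ℚ ↥K := by
  have hmono : Algebra.trdeg ℚ ↥(adjoin ℚ T) ≤ Algebra.trdeg ℚ ↥(adjoin ℚ ((K : Set ℂ) ∪ T)) :=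
    trdeg_adjoin_mono Set.subset_union_right
  refine hmono.trans (le_of_eq ?_)
  haveI : Algebra.IsAlgebraic K (adjoin K T) :=
    isAlgebraic_adjoin fun x hx => (hT x hx).isIntegral
  have h := trdeg_add_eq ℚ K (A := adjoin K T)
  rw [trdeg_eq_zero (R := K) (A := adjoin K T), add_zero] at h
  have e := (equivOfEq (restrictScalars_adjoin ℚ K T)).symm.trdeg_eq
  calc Algebra.trdeg ℚ ↥(adjoin ℚ ((K : Set ℂ) ∪ T))
      = Algebra.trdeg ℚ ↥((adjoin K T).restrictScalars ℚ) := e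
    _ = Algebra.trdeg ℚ ↥(adjoin K T) := rfl
    _ = Algebra.trdeg ℚ ↥K := h.symm

/-- PHASE CELLS DECIDED AT EVERY LENGTH: for β₁, …, β_m, γ real algebraic with (β, γ) `ℚ`-free and every `q ∈ ℚ`,
`t(β | γ + qπ) ≥ 2m + 1`.  The 2m + 1 Lindemann–Weierstrass numbers e^{β_j}, e^{iβ_j}, e^{iγ} are ALGEBRAIC over
F(β | γ + qπ) — the last one only through the PHASE `e^{i(γ+qπ)} = e^{iqπ} e^{iγ}` of the new coordinate.  X at the same
tuple («t ≥ 2m + 2»: π or e^{γ + qπ} transcendental over ℚ(e^β, e^{iβ}, e^{iγ})) is OPEN; the coordinate channel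
(«γ + qπ ∉ acl F(β)») is OPEN. -/
theorem floor_snoc_phaseShift (β : Fin m → ℝ) (γ : ℝ) (q : ℚ) (hβ : ∀ j, IsAlgebraic ℚ ((β j : ℝ) : ℂ))
    (hγ : IsAlgebraic ℚ ((γ : ℝ) : ℂ)) (hli : LinearIndependent ℚ (Fin.snoc β γ : Fin (m + 1) → ℝ)) :
    ((m + m + 1 : ℕ) : Cardinal) ≤ polarDeg (Fin.snoc β (γ + q * Real.pi) : Fin (m + 1) → ℝ) :=
  floor_of_phase_algebraic β γ hβ hγ hli (polarField (Fin.snoc β (γ + q * Real.pi) : Fin (m + 1) → ℝ))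
    (fun j => by
      simpa only [Fin.snoc_castSucc] using
        exp_coe_mem_polarField (Fin.snoc β (γ + q * Real.pi) : Fin (m + 1) → ℝ) (Fin.castSucc j))
    (fun j => by
      simpa only [Fin.snoc_castSucc] using
        exp_coe_mul_I_mem_polarField (Fin.snoc β (γ + q * Real.pi) : Fin (m + 1) → ℝ) (Fin.castSucc j))
    (isAlgebraic_exp_gamma_mul_I_phaseShift β γ q)

/-- THE CELL `SharpRelativeLindemannAt m (β | γ + qπ)` IS A THEOREM … -/
theorem sharpRelativeLindemannAt_snoc_phaseShift (β : Fin m → ℝ) (γ : ℝ) (q : ℚ)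
    (hβ : ∀ j, IsAlgebraic ℚ ((β j : ℝ) : ℂ)) (hγ : IsAlgebraic ℚ ((γ : ℝ) : ℂ))
    (hli : LinearIndependent ℚ (Fin.snoc β γ : Fin (m + 1) → ℝ)) :
    SharpRelativeLindemannAt m (Fin.snoc β (γ + q * Real.pi) : Fin (m + 1) → ℝ) :=
  fun _ _ _ => floor_snoc_phaseShift β γ q hβ hγ hli

/-- … its hyperplane (β) IS sharp … -/
theorem sharp_init_snoc_phaseShift (β : Fin m → ℝ) (γ : ℝ) (q : ℚ) (hβ : ∀ j, IsAlgebraic ℚ ((β j : ℝ) : ℂ)) :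
    polarDeg (Fin.init (Fin.snoc β (γ + q * Real.pi) : Fin (m + 1) → ℝ)) ≤ ((m + m : ℕ) : Cardinal) := by
  rw [Fin.init_snoc]
  exact polarDeg_le_two_mul_of_algebraic β hβ

/-- … and (β | γ + qπ) IS `ℚ`-free: `span_ℚ(β) ⊂ ℚ̄ ∌ γ + qπ` for `q ≠ 0` since π is TRANSCENDENTAL (Lindemann), and
for `q = 0` by hypothesis. -/
theorem linearIndependent_snoc_phaseShift (β : Fin m → ℝ) (γ : ℝ) (q : ℚ) (hβ : ∀ j, IsAlgebraic ℚ ((β j : ℝ) : ℂ))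
    (hγ : IsAlgebraic ℚ ((γ : ℝ) : ℂ)) (hli : LinearIndependent ℚ (Fin.snoc β γ : Fin (m + 1) → ℝ)) :
    LinearIndependent ℚ (Fin.snoc β (γ + q * Real.pi) : Fin (m + 1) → ℝ) := by
  have hpair := linearIndependent_finSnoc.mp hli
  refine linearIndependent_finSnoc.mpr ⟨hpair.1, fun hmem => ?_⟩
  rcases eq_or_ne q 0 with rfl | hq
  · exact hpair.2 (by simpa using hmem)
  · have halg : IsAlgebraic ℚ (((γ + q * Real.pi : ℝ)) : ℂ) := isAlgebraic_of_mem_span_algebraic β hβ hmem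
    have hq' : (q : ℂ) ≠ 0 := by exact_mod_cast hq
    have e : ((Real.pi : ℝ) : ℂ) = ((((γ + q * Real.pi : ℝ)) : ℂ) - ((γ : ℝ) : ℂ)) / (q : ℂ) := by
      push_cast
      field_simp
      ring
    have hA : ((Real.pi : ℝ) : ℂ) ∈ algebraicClosure ℚ ℂ := by
      rw [e]
      exact div_mem (sub_mem (mem_algebraicClosure_iff.mpr halg) (mem_algebraicClosure_iff.mpr hγ))
        (by rw [← eq_ratCast (algebraMap ℚ ℂ) q]; exact (algebraicClosure ℚ ℂ).algebraMap_mem q)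
    exact transcendental_coe_pi (mem_algebraicClosure_iff.mp hA)

/-- both structural hypotheses of the phase cell, packaged. -/
theorem phaseShift_cell_hypotheses (β : Fin m → ℝ) (γ : ℝ) (q : ℚ) (hβ : ∀ j, IsAlgebraic ℚ ((β j : ℝ) : ℂ))
    (hγ : IsAlgebraic ℚ ((γ : ℝ) : ℂ)) (hli : LinearIndependent ℚ (Fin.snoc β γ : Fin (m + 1) → ℝ)) :
    LinearIndependent ℚ (Fin.snoc β (γ + q * Real.pi) : Fin (m + 1) → ℝ) ∧
      polarDeg (Fin.init (Fin.snoc β (γ + q * Real.pi) : Fin (m + 1) → ℝ)) ≤ ((m + m : ℕ) : Cardinal) :=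
  ⟨linearIndependent_snoc_phaseShift β γ q hβ hγ hli, sharp_init_snoc_phaseShift β γ q hβ⟩

/-- THE PHASE CHANNEL IS CERTIFIED OPEN: `e^{i(γ + qπ)}` is transcendental over the sharp polar field F(β) — were it
algebraic, the 2m + 1 Lindemann–Weierstrass numbers would be algebraic over `F(β)(e^{iu})`, of transcendence degree
`t(β) ≤ 2m`. -/
theorem phase_transcendental_snoc_phaseShift (β : Fin m → ℝ) (γ : ℝ) (q : ℚ)
    (hβ : ∀ j, IsAlgebraic ℚ ((β j : ℝ) : ℂ)) (hγ : IsAlgebraic ℚ ((γ : ℝ) : ℂ))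
    (hli : LinearIndependent ℚ (Fin.snoc β γ : Fin (m + 1) → ℝ)) :
    Transcendental ↥(polarField β) (Complex.exp ((((γ + q * Real.pi : ℝ)) : ℂ) * Complex.I)) := by
  intro hE
  set E : ℂ := Complex.exp ((((γ + q * Real.pi : ℝ)) : ℂ) * Complex.I) with hEdef
  let L : IntermediateField ℚ ℂ := IntermediateField.adjoin ℚ (polarGens β ∪ {E})
  have hEL : E ∈ L := subset_adjoin ℚ _ (Or.inr rfl)
  have hγL : IsAlgebraic ↥L (Complex.exp (((γ : ℝ) : ℂ) * Complex.I)) := by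
    have e : Complex.exp (((γ : ℝ) : ℂ) * Complex.I) =
        E * (Complex.exp ((((q : ℝ) * Real.pi : ℝ) : ℂ) * Complex.I))⁻¹ := by
      rw [hEdef, ← Complex.exp_neg, ← Complex.exp_add]
      congr 1
      push_cast
      ring
    rw [e]
    exact (isAlgebraic_of_mem_subfield L hEL).mul ((isAlgebraic_inv_exp_rat_mul_pi_mul_I q).tower_top _)
  have h1 : ((m + m + 1 : ℕ) : Cardinal) ≤ Algebra.trdeg ℚ ↥L :=
    floor_of_phase_algebraic β γ hβ hγ hli L
      (fun j => subset_adjoin ℚ _ (Or.inl (exp_coe_mem_polarGens β j)))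
      (fun j => subset_adjoin ℚ _ (Or.inl (exp_coe_mul_I_mem_polarGens β j))) hγL
  have h2 : Algebra.trdeg ℚ ↥L ≤ polarDeg β :=
    trdeg_adjoin_le_of_isAlgebraic (polarField β) (by
      rintro x (hx | hx)
      · exact isAlgebraic_of_mem_subfield _ (subset_adjoin ℚ _ hx)
      · rw [Set.mem_singleton_iff] at hx
        rw [hx]
        exact hE)
  have h3 := polarDeg_le_two_mul_of_algebraic β hβ
  have h := h1.trans (h2.trans h3)
  norm_cast at h
  omega

/-- On the phase family the W0-cell — floor DECIDED, hyperplane (β) certified sharp, tuple certified `ℚ`-free — reads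
EXACTLY «KleinIH (m+1) → (β | γ + qπ) wild → t ≥ 2m + 2» = X there for wild such tuples (OPEN; even wildness is undecided:
the base field contains π). -/
theorem wildSharpDefectZeroAt_snoc_phaseShift_iff (β : Fin m → ℝ) (γ : ℝ) (q : ℚ)
    (hβ : ∀ j, IsAlgebraic ℚ ((β j : ℝ) : ℂ)) (hγ : IsAlgebraic ℚ ((γ : ℝ) : ℂ))
    (hli : LinearIndependent ℚ (Fin.snoc β γ : Fin (m + 1) → ℝ)) :
    WildSharpDefectZeroAt m (Fin.snoc β (γ + q * Real.pi) : Fin (m + 1) → ℝ) ↔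
      (KleinIH (m + 1) → IsWild (m + 1) (Fin.snoc β (γ + q * Real.pi) : Fin (m + 1) → ℝ) →
        ((m + 1 + (m + 1) : ℕ) : Cardinal) ≤ polarDeg (Fin.snoc β (γ + q * Real.pi) : Fin (m + 1) → ℝ)) :=
  ⟨fun h hIH hW => h (linearIndependent_snoc_phaseShift β γ q hβ hγ hli) hIH hW
      ⟨β, (linearIndependent_finSnoc.mp hli).1,
        fun j => by
          simpa only [Fin.init_snoc] using init_mem_span (Fin.snoc β (γ + q * Real.pi) : Fin (m + 1) → ℝ) j,
        polarDeg_le_two_mul_of_algebraic β hβ⟩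
      (floor_snoc_phaseShift β γ q hβ hγ hli),
    fun h _ hIH hW _ _ => h hIH hW⟩

/-- … and the T0-cell reads «KleinIH (m+1) → γ + qπ tame over the tuple → t ≥ 2m + 2» (OPEN). -/
theorem tameDefectZeroAt_snoc_phaseShift_iff (β : Fin m → ℝ) (γ : ℝ) (q : ℚ)
    (hβ : ∀ j, IsAlgebraic ℚ ((β j : ℝ) : ℂ)) (hγ : IsAlgebraic ℚ ((γ : ℝ) : ℂ))
    (hli : LinearIndependent ℚ (Fin.snoc β γ : Fin (m + 1) → ℝ)) :
    TameDefectZeroAt m (Fin.snoc β (γ + q * Real.pi) : Fin (m + 1) → ℝ) ↔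
      (KleinIH (m + 1) → LastTame m (Fin.snoc β (γ + q * Real.pi) : Fin (m + 1) → ℝ) →
        ((m + 1 + (m + 1) : ℕ) : Cardinal) ≤ polarDeg (Fin.snoc β (γ + q * Real.pi) : Fin (m + 1) → ℝ)) :=
  ⟨fun h hIH ht => h (linearIndependent_snoc_phaseShift β γ q hβ hγ hli) hIH ht (floor_snoc_phaseShift β γ q hβ hγ hli),
    fun h _ hIH ht _ => h hIH ht⟩

/-- the MODULUS family (gen-9 order: the first 2m + 1 polar exponents `β_j, γ, iβ_j` of `(β | γ)`): their exponentials are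
algebraic over any field containing `e^{β_j}, e^{iβ_j}` over which `e^γ` is algebraic. -/
theorem isAlgebraic_exp_modulusFamily (β : Fin m → ℝ) (γ : ℝ) (L : IntermediateField ℚ ℂ)
    (h1 : ∀ j, Complex.exp ((β j : ℝ) : ℂ) ∈ L) (h2 : ∀ j, Complex.exp (((β j : ℝ) : ℂ) * Complex.I) ∈ L)
    (hu : IsAlgebraic ↥L (Complex.exp ((γ : ℝ) : ℂ)))
    (i : Fin ((m + 1) + (m + 1))) (hi : (i : ℕ) < m + m + 1) :
    IsAlgebraic ↥L (Complex.exp (Fin.append (fun j => (((Fin.snoc β γ : Fin (m + 1) → ℝ) j : ℝ) : ℂ))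
        (fun j => (((Fin.snoc β γ : Fin (m + 1) → ℝ) j : ℝ) : ℂ) * Complex.I) i)) := by
  induction i using Fin.addCases with
  | left j =>
    rcases Fin.eq_castSucc_or_eq_last j with ⟨j, rfl⟩ | rfl
    · simpa only [Fin.append_left, Fin.snoc_castSucc] using isAlgebraic_of_mem_subfield L (h1 j)
    · simpa only [Fin.append_left, Fin.snoc_last] using hu
  | right j =>
    rcases Fin.eq_castSucc_or_eq_last j with ⟨j, rfl⟩ | rfl
    · simpa only [Fin.append_right, Fin.snoc_castSucc] using isAlgebraic_of_mem_subfield L (h2 j)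
    · exfalso
      rw [Fin.val_natAdd, Fin.val_last] at hi
      omega

/-- MODULUS TRANSPORT: for β_j, γ real algebraic with (β, γ) `ℚ`-free, every field `L` containing `e^{β_j}, e^{iβ_j}` over
which `e^γ` is ALGEBRAIC has `trdeg_ℚ L ≥ 2m + 1`. -/
theorem floor_of_modulus_algebraic (β : Fin m → ℝ) (γ : ℝ) (hβ : ∀ j, IsAlgebraic ℚ ((β j : ℝ) : ℂ))
    (hγ : IsAlgebraic ℚ ((γ : ℝ) : ℂ)) (hli : LinearIndependent ℚ (Fin.snoc β γ : Fin (m + 1) → ℝ))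
    (L : IntermediateField ℚ ℂ) (h1 : ∀ j, Complex.exp ((β j : ℝ) : ℂ) ∈ L)
    (h2 : ∀ j, Complex.exp (((β j : ℝ) : ℂ) * Complex.I) ∈ L) (hu : IsAlgebraic ↥L (Complex.exp ((γ : ℝ) : ℂ))) :
    ((m + m + 1 : ℕ) : Cardinal) ≤ Algebra.trdeg ℚ ↥L := by
  have hA := linearIndependent_polar hli
  have hle : m + m + 1 ≤ (m + 1) + (m + 1) := by omega
  have hLW := Literature.NumberTheory.Transcendental.algebraicIndependent_exp_holds _
    (fun k => isAlgebraic_polarExp (Fin.snoc β γ : Fin (m + 1) → ℝ) (isAlgebraic_snoc β γ hβ hγ) (Fin.castLE hle k))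
    (hA.comp (Fin.castLE hle) (Fin.castLE_injective hle))
  exact natCast_le_trdeg_of_isAlgebraic L hLW fun k =>
    isAlgebraic_exp_modulusFamily β γ L h1 h2 hu (Fin.castLE hle k) (by exact k.isLt)

/-- in F(β | γ + log α) the modulus `e^γ = e^u · α⁻¹` is ALGEBRAIC (α real algebraic, α > 0). -/
theorem isAlgebraic_exp_gamma_logShift (β : Fin m → ℝ) (γ α : ℝ) (hα : IsAlgebraic ℚ ((α : ℝ) : ℂ)) (hα0 : 0 < α) :
    IsAlgebraic ↥(polarField (Fin.snoc β (γ + Real.log α) : Fin (m + 1) → ℝ)) (Complex.exp ((γ : ℝ) : ℂ)) := by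
  have hu := exp_coe_mem_polarField (Fin.snoc β (γ + Real.log α) : Fin (m + 1) → ℝ) (Fin.last m)
  simp only [Fin.snoc_last] at hu
  have hα0' : ((α : ℝ) : ℂ) ≠ 0 := by exact_mod_cast hα0.ne'
  have e : Complex.exp ((γ : ℝ) : ℂ) = Complex.exp (((γ + Real.log α : ℝ)) : ℂ) * (((α : ℝ) : ℂ))⁻¹ := by
    rw [Complex.ofReal_add, Complex.exp_add, ← Complex.ofReal_exp (Real.log α), Real.exp_log hα0,
      mul_inv_cancel_right₀ hα0']
  rw [e]
  exact (isAlgebraic_of_mem_subfield _ hu).mul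
    ((mem_algebraicClosure_iff.mp (inv_mem (mem_algebraicClosure_iff.mpr hα))).tower_top _)

/-- MODULUS CELLS DECIDED AT EVERY LENGTH: for β₁, …, β_m, γ real algebraic with (β, γ) `ℚ`-free and every real
algebraic `α > 0`, `t(β | γ + log α) ≥ 2m + 1` — the Lindemann–Weierstrass numbers e^{β_j}, e^{iβ_j}, e^γ are algebraic
over F(β | γ + log α), the last one only through the MODULUS `e^{γ + log α} = α e^γ`.  X there and the coordinate
channel («γ + log α ∉ acl F(β)») are OPEN. -/
theorem floor_snoc_logShift (β : Fin m → ℝ) (γ α : ℝ) (hβ : ∀ j, IsAlgebraic ℚ ((β j : ℝ) : ℂ))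
    (hγ : IsAlgebraic ℚ ((γ : ℝ) : ℂ)) (hα : IsAlgebraic ℚ ((α : ℝ) : ℂ)) (hα0 : 0 < α)
    (hli : LinearIndependent ℚ (Fin.snoc β γ : Fin (m + 1) → ℝ)) :
    ((m + m + 1 : ℕ) : Cardinal) ≤ polarDeg (Fin.snoc β (γ + Real.log α) : Fin (m + 1) → ℝ) :=
  floor_of_modulus_algebraic β γ hβ hγ hli (polarField (Fin.snoc β (γ + Real.log α) : Fin (m + 1) → ℝ))
    (fun j => by
      simpa only [Fin.snoc_castSucc] using
        exp_coe_mem_polarField (Fin.snoc β (γ + Real.log α) : Fin (m + 1) → ℝ) (Fin.castSucc j))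
    (fun j => by
      simpa only [Fin.snoc_castSucc] using
        exp_coe_mul_I_mem_polarField (Fin.snoc β (γ + Real.log α) : Fin (m + 1) → ℝ) (Fin.castSucc j))
    (isAlgebraic_exp_gamma_logShift β γ α hα hα0)

/-- THE CELL `SharpRelativeLindemannAt m (β | γ + log α)` IS A THEOREM … -/
theorem sharpRelativeLindemannAt_snoc_logShift (β : Fin m → ℝ) (γ α : ℝ) (hβ : ∀ j, IsAlgebraic ℚ ((β j : ℝ) : ℂ))
    (hγ : IsAlgebraic ℚ ((γ : ℝ) : ℂ)) (hα : IsAlgebraic ℚ ((α : ℝ) : ℂ)) (hα0 : 0 < α)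
    (hli : LinearIndependent ℚ (Fin.snoc β γ : Fin (m + 1) → ℝ)) :
    SharpRelativeLindemannAt m (Fin.snoc β (γ + Real.log α) : Fin (m + 1) → ℝ) :=
  fun _ _ _ => floor_snoc_logShift β γ α hβ hγ hα hα0 hli

/-- … its hyperplane (β) IS sharp … -/
theorem sharp_init_snoc_logShift (β : Fin m → ℝ) (γ α : ℝ) (hβ : ∀ j, IsAlgebraic ℚ ((β j : ℝ) : ℂ)) :
    polarDeg (Fin.init (Fin.snoc β (γ + Real.log α) : Fin (m + 1) → ℝ)) ≤ ((m + m : ℕ) : Cardinal) := by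
  rw [Fin.init_snoc]
  exact polarDeg_le_two_mul_of_algebraic β hβ

/-- … and (β | γ + log α) IS `ℚ`-free: if `γ + log α ∈ span_ℚ(β) ⊂ ℚ̄` then `log α` is algebraic, so `log α = 0`
(HERMITE–LINDEMANN: else `e^{log α} = α` would be transcendental) and `γ ∈ span_ℚ(β)`, excluded. -/
theorem linearIndependent_snoc_logShift (β : Fin m → ℝ) (γ α : ℝ) (hβ : ∀ j, IsAlgebraic ℚ ((β j : ℝ) : ℂ))
    (hγ : IsAlgebraic ℚ ((γ : ℝ) : ℂ)) (hα : IsAlgebraic ℚ ((α : ℝ) : ℂ)) (hα0 : 0 < α)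
    (hli : LinearIndependent ℚ (Fin.snoc β γ : Fin (m + 1) → ℝ)) :
    LinearIndependent ℚ (Fin.snoc β (γ + Real.log α) : Fin (m + 1) → ℝ) := by
  have hpair := linearIndependent_finSnoc.mp hli
  refine linearIndependent_finSnoc.mpr ⟨hpair.1, fun hmem => ?_⟩
  rcases eq_or_ne (Real.log α) 0 with h0 | h0
  · exact hpair.2 (by simpa [h0] using hmem)
  · have halg : IsAlgebraic ℚ (((γ + Real.log α : ℝ)) : ℂ) := isAlgebraic_of_mem_span_algebraic β hβ hmem
    have e : (((γ + Real.log α : ℝ)) : ℂ) - ((γ : ℝ) : ℂ) = ((Real.log α : ℝ) : ℂ) := by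
      push_cast
      ring
    have hlog : IsAlgebraic ℚ ((Real.log α : ℝ) : ℂ) := by
      have hA := sub_mem (mem_algebraicClosure_iff.mpr halg) (mem_algebraicClosure_iff.mpr hγ)
      rw [e] at hA
      exact mem_algebraicClosure_iff.mp hA
    have hT : AlgebraicIndependent ℚ fun i : Fin 1 => Complex.exp (![((Real.log α : ℝ) : ℂ)] i) :=
      Literature.NumberTheory.Transcendental.algebraicIndependent_exp_holds _
        (fun i => by fin_cases i; exact hlog) (linearIndependent_unique_iff.mpr (by simpa using h0))
    have hT0 := hT.transcendental 0
    simp only [Matrix.cons_val_fin_one, ← Complex.ofReal_exp, Real.exp_log hα0] at hT0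
    exact hT0 hα

/-- the structural hypotheses of the log-shift cell (β ∣ γ + log α) are theorems. -/
theorem logShift_cell_hypotheses (β : Fin m → ℝ) (γ α : ℝ) (hβ : ∀ j, IsAlgebraic ℚ ((β j : ℝ) : ℂ))
    (hγ : IsAlgebraic ℚ ((γ : ℝ) : ℂ)) (hα : IsAlgebraic ℚ ((α : ℝ) : ℂ)) (hα0 : 0 < α)
    (hli : LinearIndependent ℚ (Fin.snoc β γ : Fin (m + 1) → ℝ)) :
    LinearIndependent ℚ (Fin.snoc β (γ + Real.log α) : Fin (m + 1) → ℝ) ∧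
      polarDeg (Fin.init (Fin.snoc β (γ + Real.log α) : Fin (m + 1) → ℝ)) ≤ ((m + m : ℕ) : Cardinal) :=
  ⟨linearIndependent_snoc_logShift β γ α hβ hγ hα hα0 hli, sharp_init_snoc_logShift β γ α hβ⟩

/-- THE MODULUS CHANNEL IS CERTIFIED OPEN: `e^{γ + log α} = α e^γ` is transcendental over the sharp polar field F(β). -/
theorem modulus_transcendental_snoc_logShift (β : Fin m → ℝ) (γ α : ℝ) (hβ : ∀ j, IsAlgebraic ℚ ((β j : ℝ) : ℂ))
    (hγ : IsAlgebraic ℚ ((γ : ℝ) : ℂ)) (hα : IsAlgebraic ℚ ((α : ℝ) : ℂ)) (hα0 : 0 < α)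
    (hli : LinearIndependent ℚ (Fin.snoc β γ : Fin (m + 1) → ℝ)) :
    Transcendental ↥(polarField β) (Complex.exp (((γ + Real.log α : ℝ)) : ℂ)) := by
  intro hE
  set E : ℂ := Complex.exp (((γ + Real.log α : ℝ)) : ℂ) with hEdef
  let L : IntermediateField ℚ ℂ := IntermediateField.adjoin ℚ (polarGens β ∪ {E})
  have hEL : E ∈ L := subset_adjoin ℚ _ (Or.inr rfl)
  have hα0' : ((α : ℝ) : ℂ) ≠ 0 := by exact_mod_cast hα0.ne'
  have hγL : IsAlgebraic ↥L (Complex.exp ((γ : ℝ) : ℂ)) := by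
    have e : Complex.exp ((γ : ℝ) : ℂ) = E * (((α : ℝ) : ℂ))⁻¹ := by
      rw [hEdef, Complex.ofReal_add, Complex.exp_add, ← Complex.ofReal_exp (Real.log α), Real.exp_log hα0,
        mul_inv_cancel_right₀ hα0']
    rw [e]
    exact (isAlgebraic_of_mem_subfield L hEL).mul
      ((mem_algebraicClosure_iff.mp (inv_mem (mem_algebraicClosure_iff.mpr hα))).tower_top _)
  have h1 : ((m + m + 1 : ℕ) : Cardinal) ≤ Algebra.trdeg ℚ ↥L :=
    floor_of_modulus_algebraic β γ hβ hγ hli L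
      (fun j => subset_adjoin ℚ _ (Or.inl (exp_coe_mem_polarGens β j)))
      (fun j => subset_adjoin ℚ _ (Or.inl (exp_coe_mul_I_mem_polarGens β j))) hγL
  have h2 : Algebra.trdeg ℚ ↥L ≤ polarDeg β :=
    trdeg_adjoin_le_of_isAlgebraic (polarField β) (by
      rintro x (hx | hx)
      · exact isAlgebraic_of_mem_subfield _ (subset_adjoin ℚ _ hx)
      · rw [Set.mem_singleton_iff] at hx
        rw [hx]
        exact hE)
  have h3 := polarDeg_le_two_mul_of_algebraic β hβ
  have h := h1.trans (h2.trans h3)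
  norm_cast at h
  omega

/-- CENSUS OF GEN 9, made precise: on the Lindemann–Weierstrass family (β | e^γ) the COORDINATE channel was the open one —
`e^γ` is transcendental over F(β). -/
theorem coordinate_transcendental_snoc_exp (β : Fin m → ℝ) (γ : ℝ) (hβ : ∀ j, IsAlgebraic ℚ ((β j : ℝ) : ℂ))
    (hγ : IsAlgebraic ℚ ((γ : ℝ) : ℂ)) (hli : LinearIndependent ℚ (Fin.snoc β γ : Fin (m + 1) → ℝ)) :
    Transcendental ↥(polarField β) ((Real.exp γ : ℝ) : ℂ) := by
  rw [Complex.ofReal_exp]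
  intro hE
  let L : IntermediateField ℚ ℂ := IntermediateField.adjoin ℚ (polarGens β ∪ {Complex.exp ((γ : ℝ) : ℂ)})
  have h1 : ((m + m + 1 : ℕ) : Cardinal) ≤ Algebra.trdeg ℚ ↥L :=
    floor_of_modulus_algebraic β γ hβ hγ hli L
      (fun j => subset_adjoin ℚ _ (Or.inl (exp_coe_mem_polarGens β j)))
      (fun j => subset_adjoin ℚ _ (Or.inl (exp_coe_mul_I_mem_polarGens β j)))
      (isAlgebraic_of_mem_subfield L (subset_adjoin ℚ _ (Or.inr rfl)))
  have h2 : Algebra.trdeg ℚ ↥L ≤ polarDeg β :=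
    trdeg_adjoin_le_of_isAlgebraic (polarField β) (by
      rintro x (hx | hx)
      · exact isAlgebraic_of_mem_subfield _ (subset_adjoin ℚ _ hx)
      · rw [Set.mem_singleton_iff] at hx
        rw [hx]
        exact hE)
  have h3 := polarDeg_le_two_mul_of_algebraic β hβ
  have h := h1.trans (h2.trans h3)
  norm_cast at h
  omega

/-- the NESTERENKO MODULUS cell (π | log Γ(1/4)) … -/
noncomputable def piLogGamma : Fin 2 → ℝ := ![Real.pi, Real.log (Real.Gamma (1 / 4))]

/-- … and the NESTERENKO PHASE cell (π | arctan Γ(1/4)). -/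
noncomputable def piArctanGamma : Fin 2 → ℝ := ![Real.pi, Real.arctan (Real.Gamma (1 / 4))]

/-- `0 < Real.Gamma (1 / 4)`. -/
private theorem Gamma_one_four_pos : 0 < Real.Gamma (1 / 4) := Real.Gamma_pos_of_pos (by norm_num)

/-- `Fin.init piLogGamma = ![Real.pi]`. -/
theorem init_piLogGamma : Fin.init piLogGamma = ![Real.pi] := by
  funext j
  fin_cases j
  rfl

/-- `Fin.init piArctanGamma = ![Real.pi]`. -/
theorem init_piArctanGamma : Fin.init piArctanGamma = ![Real.pi] := by
  funext j
  fin_cases j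
  rfl

/-- the MODULUS of the last coordinate of (π | log Γ(1/4)) IS Γ(1/4). -/
theorem exp_piLogGamma_one : Complex.exp ((piLogGamma 1 : ℝ) : ℂ) = ((Real.Gamma (1 / 4) : ℝ) : ℂ) := by
  rw [show piLogGamma 1 = Real.log (Real.Gamma (1 / 4)) from rfl, ← Complex.ofReal_exp, Real.exp_log Gamma_one_four_pos]

/-- the PHASE of the last coordinate of (π | arctan Γ(1/4)) KNOWS Γ(1/4): `tan u = Γ(1/4)`. -/
theorem tan_piArctanGamma_one : Complex.tan ((piArctanGamma 1 : ℝ) : ℂ) = ((Real.Gamma (1 / 4) : ℝ) : ℂ) := by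
  rw [show piArctanGamma 1 = Real.arctan (Real.Gamma (1 / 4)) from rfl, ← Complex.ofReal_tan, Real.tan_arctan]

/-- `e^{cπ}` (c rational) is algebraic over F(π): its `den c`-th power is `(e^π)^{num c}`. -/
theorem isAlgebraic_exp_rat_mul_pi (c : ℚ) :
    IsAlgebraic ↥(polarField ![Real.pi]) (Complex.exp ((((c : ℝ) * Real.pi : ℝ)) : ℂ)) := by
  refine isAlgebraic_of_pow_mem_subfield _ c.den_pos ?_
  rw [← Complex.exp_nat_mul]
  have e2 : ((c.den : ℕ) : ℂ) * ((((c : ℝ) * Real.pi : ℝ)) : ℂ) = (c.num : ℂ) * ((Real.pi : ℝ) : ℂ) := by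
    rw [← rat_mul_den_complex c]
    push_cast
    ring
  rw [e2, Complex.exp_int_mul]
  exact zpow_mem (exp_coe_mem_polarField ![Real.pi] 0) _

end

end Summit.Schanuel.Schanuel.Theorems.RootDecomp1BDefectFloorChannels
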